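import Mathlib
import Summits.ValiantsHypothesis.ValiantsHypothesis.Theorems.NewtonFramesNewtonTauWeakBlockConvexLagrange

/-!
# Tower graft line, stubs S2a + S2b: blow-ups stay dissociated; the tower tie-breaker is dissociated

By-name closers for two registered stubs of the line `Cruxes/WeakLifting/Lines/tower_graft.lean` (commit 93fc8a4763ba,
crux `WeakLifting` = stmt-ValiantsHypothesis-19561, restricted sub-case `TowerWeakLifting`; line planner val-idea-24 g0,
critic of record val-idea-crit-6 g0, director R266 (B)/R268, lead g27 R2667 (B)):

* `blowup_dissociated` = **S2a `stub_blowupDissociated`** VERBATIM with the line's `IsDissociated` inlined: if `e` is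
  `m`-dissociated (distinct class-count vectors `n` of total `m` give distinct `∑ n l · e l`) and `N > m · e l` for all `l`,
  then the blown-up support `N · d + e` is `m`-dissociated.  Proof: `∑ n l (N d l + e l) = N·∑ n l d l + ∑ n l e l` with the
  remainder `∑ n l e l < N` (as `m · e l ≤ N − 1` and `∑ n l = m`), so equal blown-up exponents have equal remainders
  (`% N`), and dissociation of `e` gives `n = n'`.
* `tower_tieBreaker_dissociated` = **S2b `stub_towerTieBreaker`** VERBATIM (inlined): `e l = (m+1)^l` is `m`-dissociated —
  base-`(m+1)` digit vectors with digits `n l ≤ m` are determined by their value (tree lemma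
  `…NewtonFramesNewtonTauWeak.BlockConvexLagrange.digits_injective`, reused — not restated).

The line discharges both stubs by `exact` (definitional unfolding of `IsDissociated`).  Def-free; Mathlib + one tree lemma.
HONEST FRAMING: elementary arithmetic joints of a skeleton for a RESTRICTED sub-case (`TowerWeakLifting`) of the crux; nothing
here bears on `WeakLifting` itself, on Conjecture B / `KPlusLogSqLaw`, on `MatrixDescartes` (18050) or on `VP ≠ VNP`.
Seat: prover val-sym-lift-p2 g17, `--supports stmt-ValiantsHypothesis-19561`.
-/

-- `Summit.ValiantsHypothesis.ValiantsHypothesis.…` repeats a component by the D-0017 layout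
-- (single-conjunct summit), which the `dupNamespace` linter flags; the name is mandated.
set_option linter.dupNamespace false

namespace Summit.ValiantsHypothesis.ValiantsHypothesis.Theorems.KPlusLogSqLaw.TowerGraft

open Finset

/-- **S2b `stub_towerTieBreaker` (verbatim, `IsDissociated` inlined).**  The tower tie-breaker `e l = (m+1)^l` is
`m`-dissociated: class-count vectors of total `m` are base-`(m+1)` digit vectors, determined by `∑ l, n l · (m+1)^l`. [this work] -/
theorem tower_tieBreaker_dissociated (m K : ℕ) :
    ∀ n n' : Fin K → ℕ, ∑ l, n l = m → ∑ l, n' l = m →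
      ∑ l, n l * (m + 1) ^ (l : ℕ) = ∑ l, n' l * (m + 1) ^ (l : ℕ) → n = n' := by
  intro n n' hn hn' hsum
  refine Summit.ValiantsHypothesis.ValiantsHypothesis.Theorems.NewtonFramesNewtonTauWeak.BlockConvexLagrange.digits_injective
    (m + 1) K n n' (fun l => ?_) (fun l => ?_) hsum
  · have := Finset.single_le_sum (f := n) (fun i _ => Nat.zero_le _) (Finset.mem_univ l); omega
  · have := Finset.single_le_sum (f := n') (fun i _ => Nat.zero_le _) (Finset.mem_univ l); omega

/-- The remainder of a blown-up exponent: `∑ l, n l · e l < N` when `∑ l, n l = m` and `m · e l < N` for all `l`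
(and some letter exists). [this work] -/
theorem classSum_mul_lt (m K N : ℕ) (e : Fin K → ℕ) (hN : ∀ l, m * e l < N) (l₀ : Fin K)
    (n : Fin K → ℕ) (hn : ∑ l, n l = m) : ∑ l, n l * e l < N := by
  have hNpos : 0 < N := lt_of_le_of_lt (Nat.zero_le _) (hN l₀)
  rcases Nat.eq_zero_or_pos m with hm | hm
  · subst hm
    have h0 : ∀ l, n l = 0 := fun l => by
      have := Finset.single_le_sum (f := n) (fun i _ => Nat.zero_le _) (Finset.mem_univ l); omega
    simp [h0, hNpos]
  · -- `m · ∑ n l e l = ∑ n l (m e l) ≤ ∑ n l (N - 1) = m (N - 1) < m N`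
    have h1 : m * ∑ l, n l * e l ≤ m * (N - 1) := by
      calc m * ∑ l, n l * e l = ∑ l, n l * (m * e l) := by
            rw [Finset.mul_sum]; exact Finset.sum_congr rfl fun l _ => by ring
        _ ≤ ∑ l, n l * (N - 1) := Finset.sum_le_sum fun l _ => Nat.mul_le_mul_left _ (by have := hN l; omega)
        _ = m * (N - 1) := by rw [← Finset.sum_mul, hn]
    have h2 : m * ∑ l, n l * e l < m * N := lt_of_le_of_lt h1 (Nat.mul_lt_mul_of_pos_left (by omega) hm)
    exact Nat.lt_of_mul_lt_mul_left h2

/-- **S2a `stub_blowupDissociated` (verbatim, `IsDissociated` inlined).**  If `e` is `m`-dissociated and `N > m · e l`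
for every `l`, the blown-up support `l ↦ N · d l + e l` is `m`-dissociated: `∑ n l (N d l + e l) = N · ∑ n l d l + ∑ n l e l`
with remainder `< N`, so equal exponents have equal remainders and dissociation of `e` gives `n = n'`. [this work] -/
theorem blowup_dissociated (m K N : ℕ) (d e : Fin K → ℕ)
    (he : ∀ n n' : Fin K → ℕ, ∑ l, n l = m → ∑ l, n' l = m → ∑ l, n l * e l = ∑ l, n' l * e l → n = n')
    (hN : ∀ l, m * e l < N) :
    ∀ n n' : Fin K → ℕ, ∑ l, n l = m → ∑ l, n' l = m →
      ∑ l, n l * (N * d l + e l) = ∑ l, n' l * (N * d l + e l) → n = n' := by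
  intro n n' hn hn' hsum
  rcases isEmpty_or_nonempty (Fin K) with hK | ⟨⟨l₀⟩⟩
  · funext l; exact isEmptyElim l
  have split : ∀ f : Fin K → ℕ, ∑ l, f l * (N * d l + e l) = N * ∑ l, f l * d l + ∑ l, f l * e l := by
    intro f
    rw [Finset.mul_sum, ← Finset.sum_add_distrib]
    exact Finset.sum_congr rfl fun l _ => by ring
  rw [split n, split n'] at hsum
  have hr := classSum_mul_lt m K N e hN l₀ n hn
  have hr' := classSum_mul_lt m K N e hN l₀ n' hn'
  have hmod := congrArg (· % N) hsum
  simp only [Nat.mul_add_mod_self_left, Nat.mod_eq_of_lt hr, Nat.mod_eq_of_lt hr'] at hmod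
  exact he n n' hn hn' hmod

end Summit.ValiantsHypothesis.ValiantsHypothesis.Theorems.KPlusLogSqLaw.TowerGraft
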